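import Summits.MatrixMultiplication.MatrixMultiplication.Theorems.SoloInformedNearRectAssembly

/-!
# THEOREM 8.19 in the Step-3.1 shape: `a` near-constant on a box, `b` near-constant column-wise

This work, §8.8 (T12)(f) Step 3.1 (last sentence) and C3-m2 §5.5–5.6 (B) (gen 107). Setting as in
`SoloInformedNearRectAssembly`.

At the end of Step 3.1 of THEOREM 8.20 one has: `a ∼ α` on `I₁ × Jp` off `≤ d` entries in every row (`Ea i`) and in
every column (`Ec j`), and — on the larger SAME-group `Kg` of dirty columns — `b(·,k) ∼ β` on `Jp` off `≤ d` rows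
(`Fb k`), i.e. COLUMN-wise only. `Data.nearRect_cols` discards the heavy rows of `b` (rows `j ∈ Jp` lying in `> d′`
of the sets `Fb k`; at most `|Kg|·d/(d′+1)` of them, by double counting) and applies `Data.nearRect` with
`e := d + d′` on `I₁ × L × Kg`, `L` the light rows; the output is `Data.nearRect`'s trichotomy, conditional on
`2(d+d′) < |L|`, together with the heavy-row count.
-/

namespace Summit.MatrixMultiplication.MatrixMultiplication.Theorems.TwistedTPP

namespace FibreLines

variable {ι G : Type*} [AddCommGroup G]
variable {G₀ : Type*} [AddCommGroup G₀] {R : Type*}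

/-- **THEOREM 8.19 in the Step-3.1 shape.** [this work, §8.8 (T12)(f) Step 3.1; C3-m2 §5.5] -/
theorem Data.nearRect_cols [Fintype ι] [DecidableEq ι] [Fintype G₀] [DecidableEq G₀] [Fintype R]
    [DecidableEq R] [DecidableEq G] (hG : ∀ x : G, x = -x → x = 0) (D : Data ι G) (Φ : Chart ι G₀)
    (κ : G → R) (hκ : ∀ x y, κ x = κ y → SignEq x y) (hsep : D.SepAll Φ) {α β : G} (hβ : β ≠ 0)
    (hα : α ≠ 0) (hβα : ¬ SignEq β α) (I₁ Jp Kg : Finset ι) (d d' : ℕ) (Ea Ec Fb : ι → Finset ι)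
    (hEa : ∀ i ∈ I₁, (Ea i).card ≤ d ∧ ∀ j ∈ Jp, j ∉ Ea i → SignEq (D.a i j) α)
    (hEc : ∀ j ∈ Jp, (Ec j).card ≤ d ∧ ∀ i ∈ I₁, i ∉ Ec j → SignEq (D.a i j) α)
    (hFb : ∀ k ∈ Kg, (Fb k).card ≤ d ∧ ∀ j ∈ Jp, j ∉ Fb k → SignEq (D.b j k) β) :
    ∃ L ⊆ Jp, (Jp.card - L.card) * (d' + 1) ≤ Kg.card * d ∧ (2 * (d + d') < L.card →
      ∃ Kc ⊆ Kg, ∃ Kp ⊆ Kg, ∃ Km ⊆ Kg, Kg.card = Kc.card + Kp.card + Km.card ∧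
        Fintype.card ι * Kc.card * L.card ≤ Fintype.card R * Fintype.card G₀ ∧
        (2 * (d + d') < Kp.card → ∃ I₂ ⊆ I₁, I₁.card ≤ I₂.card + 2 * (d + d') ∧
          I₂.card * L.card * Kp.card ≤ Fintype.card G₀ + (d + d') * (L.card * Kp.card) +
            (d + d') * (L.card * I₂.card) + (d + d') * (Kp.card * L.card)) ∧
        (2 * (d + d') < Km.card → ∃ I₂ ⊆ I₁, I₁.card ≤ I₂.card + 2 * (d + d') ∧
          I₂.card * L.card * Km.card ≤ Fintype.card G₀ + (d + d') * (L.card * Km.card) +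
            (d + d') * (L.card * I₂.card) + (d + d') * (Km.card * L.card))) := by
  classical
  set L : Finset ι := Jp.filter fun j => (Kg.filter fun k => j ∈ Fb k).card ≤ d' with hLdef
  set H : Finset ι := Jp.filter fun j => ¬ (Kg.filter fun k => j ∈ Fb k).card ≤ d' with hH
  have hsplit : L.card + H.card = Jp.card := Finset.card_filter_add_card_filter_not _
  have hcount : H.card • (d' + 1) ≤ Kg.card • d := by
    refine Finset.card_nsmul_le_card_nsmul (r := fun j k => j ∈ Fb k) ?_ ?_
    · intro j hj
      have h1 : ¬ (Kg.filter fun k => j ∈ Fb k).card ≤ d' := (Finset.mem_filter.1 hj).2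
      have h2 : (Kg.filter fun k => j ∈ Fb k) = Kg.bipartiteAbove (fun j k => j ∈ Fb k) j := rfl
      exact le_trans (by omega) (le_of_eq (congrArg Finset.card h2))
    · intro k hk
      have hsub : H.bipartiteBelow (fun j k => j ∈ Fb k) k ⊆ Fb k := by
        intro j hj
        rw [Finset.mem_bipartiteBelow] at hj
        exact hj.2
      exact (Finset.card_le_card hsub).trans (hFb k hk).1
  rw [smul_eq_mul, smul_eq_mul] at hcount
  refine ⟨L, Finset.filter_subset _ _, by
    have : Jp.card - L.card = H.card := by omega
    rw [this]; exact hcount, fun hL => ?_⟩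
  have hLJ : ∀ j ∈ L, j ∈ Jp := fun j hj => (Finset.mem_filter.1 hj).1
  have hac : ∀ j ∈ L, ∃ E : Finset ι, E.card ≤ d + d' ∧ ∀ i ∈ I₁, i ∉ E → SignEq (D.a i j) α :=
    fun j hj => ⟨Ec j, by have := (hEc j (hLJ j hj)).1; omega, fun i hi hiE => (hEc j (hLJ j hj)).2 i hi hiE⟩
  have har : ∀ i ∈ I₁, ∃ E : Finset ι, E.card ≤ d + d' ∧ ∀ j ∈ L, j ∉ E → SignEq (D.a i j) α :=
    fun i hi => ⟨Ea i, by have := (hEa i hi).1; omega, fun j hj hjE => (hEa i hi).2 j (hLJ j hj) hjE⟩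
  have hbr : ∀ j ∈ L, ∃ E : Finset ι, E.card ≤ d + d' ∧ ∀ k ∈ Kg, k ∉ E → SignEq (D.b j k) β := by
    intro j hj
    refine ⟨Kg.filter fun k => j ∈ Fb k, by have := (Finset.mem_filter.1 hj).2; omega,
      fun k hk hkE => ?_⟩
    exact (hFb k hk).2 j (hLJ j hj) fun h => hkE (Finset.mem_filter.2 ⟨hk, h⟩)
  have hbc : ∀ k ∈ Kg, ∃ E : Finset ι, E.card ≤ d + d' ∧ ∀ j ∈ L, j ∉ E → SignEq (D.b j k) β :=
    fun k hk => ⟨Fb k, by have := (hFb k hk).1; omega, fun j hj hjE => (hFb k hk).2 j (hLJ j hj) hjE⟩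
  exact D.nearRect hG Φ κ hκ hsep hβ hα hβα I₁ L Kg (d + d') hac har hbr hbc hL

end FibreLines

end Summit.MatrixMultiplication.MatrixMultiplication.Theorems.TwistedTPP
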